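import Summits.FinalStateConjecture.FinalStateConjecture.Theses.TemporalBandLiouville
import Summits.FinalStateConjecture.FinalStateConjecture.Theses.EternalPapapetrou
import HarnessLib.Audit

/-!
# Birth skeleton (BC3) for crux `TemporalBandLiouville.StationaryLimitReduction`

Item stmt-FinalStateConjecture-10173 (shared verbatim by route-FinalStateConjecture-TemporalBandLiouville,
rank 4, and route-FinalStateConjecture-LeakageWritesInInk, rank 4; `shared_closes`), registrar
planner-skel-stmt-FinalStateConjecture-10173-0, 2026-08-17. Route re-audit bin REPAIRABLE: the crux had no
elaborating skeleton.

Crux (fixed, by name): `StationaryLimitReduction := EternalExteriorStationary → FinalStateConjecture` — the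
STATIONARY-LIMIT ARCHITECTURE: the eternal harmonic-gauge Liouville theorem X (an eternal, two-sided
`C^k`-bounded, non-radiating vacuum exterior on the excised cylinder `Kerr.region a r₀`, in harmonic
coordinates, is `t`-independent) implies the final state conjecture. Informally (route file): (i) ω-limits of
late exteriors exist in X's class or are empty, (ii) X makes them stationary, smooth black-hole uniqueness makes
them Kerr, (iii) generic censorship + capture upgrade subsequential `C⁰` convergence to the Statement's `C²`
sub-extremal `FinalStateDecomposition` with exhaustive, future-oriented charts.

## The line: X docks on the EternalPapapetrou seam (pointwise `C⁰` settling × ONE tame-generic clause)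

The route-review refuter (refuter-rreview-0815T15-9-0, note on this item) asked the stationary-limit routes to
converge on ONE typed architecture. Route EternalPapapetrou already carries it, vetted and gate-certified
(its `closes` elaborates): a POINTWISE dynamical theorem T = `EternalPapapetrou.CompleteScriSettlesC0`
(item 17273: every maximal vacuum Cauchy development of EVERY admissible datum with complete `𝓘⁺` settles in
`C⁰` — `FinalStateDecomposition … 0`, extremal holes allowed — with `O = exteriorOf`, `RaysStayInClosure`,
`HasExhaustiveCharts`, `IsFutureOriented`) and ONE tame-generic clause G =
`EternalPapapetrou.GenericCensoredCapture` (item 17308: tame-Christodoulou-generically the MGHD exists, every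
MGHD has complete `𝓘⁺`, and every such `C⁰` decomposition upgrades to a `C²` one with sub-extremal holes).
EternalPapapetrou feeds T from its FAR-ZONE Liouville L and the eternal rigidity U =
`EternalPapapetrou.EternalStationaryExteriorIsKerr` (item 10745) via `LaSalleTransfer : L → U → T`.
THIS crux replaces L by the route's GLOBAL Liouville X: the three stubs are

* `stub_omegaLimitTransfer : X → U → T` (XL, HARDEST — "stability in the large"): late-time translates of the
  exterior of an MGHD with complete `𝓘⁺` are precompact in comoving HARMONIC gauge with excision inside the
  apparent horizon (two-sided `C^k` bounds) and every ω-limit is an eternal vacuum exterior which is two-sided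
  non-radiating at the stationary rates of X (Bondi mass and area monotone and bounded ⇒ no outgoing news in
  the limit; asymptotic flatness of the datum ⇒ no incoming radiation at late advanced time) — so X makes every
  BLACK-HOLE ω-limit `t`-independent in its global harmonic chart, in particular stationary near infinity, which
  is the input of U; U identifies the limit's d.o.c. with a Kerr exterior (`|a| ≤ M′`) or Minkowski space;
  isolation of the Kerr family among the limits + monotone Bondi mass ⇒ parameters converge along the whole
  flow, `N` is finite, holes separate sublinearly, and horizon-normalised ingoing Kerr–Schild charts give the
  `C⁰` decomposition with honest growing radii, rays in `closure O`, exhaustion and future orientation.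
  NAMED RESIDUALS of this stub (not hidden): (a) the compactness itself (no theorem; weak limits may exit
  vacuum, Burnett/arXiv:1907.10743); (b) HORIZONLESS non-dispersing eternal limits — X needs the inflow collar,
  so for them far-zone stationarity (U's input) must come from a no-geon / far-Liouville argument or they must be
  shown absent (the crux's informal "(or is empty)"); (c) EXTREMAL limits — X's collar class excludes them
  (no region with `dr` timelike), U allows `|a| ≤ M′` but still wants far stationarity.
* `stub_stationaryRigidity : U` (open problem; = EternalPapapetrou item 10745 BY NAME, shared work): eternal,
  Ricci-flat, globally hyperbolic spacetimes with an eternal far chart of bounded geometry, two-sided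
  non-radiating, stationary near infinity, black-hole or geodesically complete, have d.o.c. isometric to a Kerr
  exterior or are Minkowski (smooth no-hair without analyticity: Alexakis–Ionescu–Klainerman only near Kerr).
  In this line U re-does the inward Killing extension that X already supplies in harmonic gauge; a sharper
  rigidity stub "globally stationary harmonic-gauge excised exteriors are Kerr" is the natural reshape once
  typed (left to crux-plan; U by name is the vetted statement available today).
* `stub_genericCensoredCapture : G` (open problem — weak cosmic censorship in tame form + the `C⁰ ⇒ C²`
  sub-extremal upgrade; = EternalPapapetrou item 17308 BY NAME, shared work).

Composition `StationaryLimitReduction_of` (sorry-free, below, 20 lines = EternalPapapetrou's certified `closes`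
logic with `h₁ hX h₂` for `h₅ h₂ h₄`): T := stub₁ X U; tame Christodoulou-genericity of codimension 1 is
MONOTONE in the property (the tame immersed injective family through a Q-exceptional datum works for any
weaker P); pointwise on admissible data, G's property and T give the Statement's property by threading
`RaysStayInClosure` / `HasExhaustiveCharts` / `IsFutureOriented` through the `C⁰ ⇒ C²` upgrade.

Disproof used. No `Disproof.lean` exists for THIS item; the directory's `Cruxes/StationaryLimitReduction/Disproof.lean`
belongs to the homonymous crux stmt-10021 (`KerrOrBomb → FinalStateConjecture`, route ZeroEnergyKerrOrBomb) and three
of its checked sections transfer verbatim in shape and are HONOURED here: §1 `crux_iff_summit_of_target` (given the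
target, a reduction crux IS the summit — so the stubs jointly carry the summit's dynamical content and no single
stub may; BC3 probes below), §5 `genericity_not_and_closed` (curve-genericity is not `∧`-closed — genericity enters
ONLY through stub 3, stated once; stubs 1–2 are pointwise), §7 far-field FOCUSING packets (pointwise `C²` settling
over `admissibleVacuumData` is refuter-level false: DR `(2,1)` weights protect late `C¹`, not `C²` — stub 1
concludes `C⁰` only, and the `C²` upgrade lives inside the generic clause of stub 3, where the escape-by-far-field-
truncation is available). Negatives index (`ledger negatives --problem FinalStateConjecture`, 2026-08-17): one entry
(`not_UniformPhotonSphereChannels`), unrelated to every stub.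
-/

namespace Summit.FinalStateConjecture.FinalStateConjecture.Cruxes.StationaryLimitReduction.TemporalBandLiouvilleBirth

set_option linter.dupNamespace false

open Literature.Geometry.Lorentzian
open Summit.FinalStateConjecture.FinalStateConjecture.Theses

/-! ## The three registered stubs -/

/-- **Registered stub 1 — ω-limit transfer (XL, HARDEST).** Given the route's eternal harmonic-gauge
Liouville statement X (`TemporalBandLiouville.EternalExteriorStationary`) and eternal rigidity U
(`EternalPapapetrou.EternalStationaryExteriorIsKerr`), every maximal vacuum Cauchy development of every
admissible datum with complete `𝓘⁺` settles in `C⁰` (`EternalPapapetrou.CompleteScriSettlesC0`): ω-limit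
precompactness of late exteriors in comoving harmonic gauge with excision, two-sided non-radiation of the limits
at stationary rates, X ⇒ black-hole limits stationary, U ⇒ Kerr/Minkowski, isolation + monotone Bondi mass ⇒
parameter convergence, finitely many sublinearly separating holes, `C⁰` exhaustive future-oriented charts.
Residuals named in the module docstring: compactness; horizonless non-dispersing limits; extremal limits. -/
theorem stub_omegaLimitTransfer :
    Summit.FinalStateConjecture.FinalStateConjecture.Theses.TemporalBandLiouville.EternalExteriorStationary →
      Summit.FinalStateConjecture.FinalStateConjecture.Theses.EternalPapapetrou.EternalStationaryExteriorIsKerr →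
        Summit.FinalStateConjecture.FinalStateConjecture.Theses.EternalPapapetrou.CompleteScriSettlesC0 := by
  sorry

/-- **Registered stub 2 — eternal stationary rigidity (open problem; EternalPapapetrou item 10745 by name).**
Smooth no-hair for eternal two-sided non-radiating Ricci-flat globally hyperbolic spacetimes which are
stationary near infinity and black-hole-or-complete: the d.o.c. of the far end is isometric to a Kerr exterior
(`0 < M′`, `|a| ≤ M′`), or the spacetime is Minkowski. -/
theorem stub_stationaryRigidity :
    Summit.FinalStateConjecture.FinalStateConjecture.Theses.EternalPapapetrou.EternalStationaryExteriorIsKerr := by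
  sorry

/-- **Registered stub 3 — generic censored capture (open problem; EternalPapapetrou item 17308 by name).**
Tame-Christodoulou-generically (codimension 1, one fixed end) in `admissibleVacuumData X`: a maximal vacuum
Cauchy development exists, every maximal one has complete `𝓘⁺`, and every `C⁰` exhaustive future-oriented
final-state decomposition of its self-determined exterior with rays in the closure upgrades to a `C²` one with
sub-extremal holes (weak cosmic censorship + dynamical third law + `C⁰ ⇒ C²` capture, stated ONCE because
curve-genericity is not closed under conjunction). -/
theorem stub_genericCensoredCapture :
    Summit.FinalStateConjecture.FinalStateConjecture.Theses.EternalPapapetrou.GenericCensoredCapture := by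
  sorry

/-! ## Registered stub signatures (by name, for `ledger skeleton check` / `#h21_check_skeleton`)

Convention of the registered skeletons of this summit (`namespace Registered`): each `Registered.stub_<name>` is
the statement of the theorem `stub_<name>` above, verbatim, so that the composition takes its hypotheses BY NAME. -/
namespace Registered

/-- Registered signature of `stub_omegaLimitTransfer` (verbatim). -/
abbrev stub_omegaLimitTransfer : Prop :=
  Summit.FinalStateConjecture.FinalStateConjecture.Theses.TemporalBandLiouville.EternalExteriorStationary →
    Summit.FinalStateConjecture.FinalStateConjecture.Theses.EternalPapapetrou.EternalStationaryExteriorIsKerr →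
      Summit.FinalStateConjecture.FinalStateConjecture.Theses.EternalPapapetrou.CompleteScriSettlesC0

/-- Registered signature of `stub_stationaryRigidity` (verbatim). -/
abbrev stub_stationaryRigidity : Prop :=
  Summit.FinalStateConjecture.FinalStateConjecture.Theses.EternalPapapetrou.EternalStationaryExteriorIsKerr

/-- Registered signature of `stub_genericCensoredCapture` (verbatim). -/
abbrev stub_genericCensoredCapture : Prop :=
  Summit.FinalStateConjecture.FinalStateConjecture.Theses.EternalPapapetrou.GenericCensoredCapture

end Registered

/-- The registered signatures ARE the statements of the three `stub_*` theorems (checked by ascription; these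
`example`s elaborate no `sorry` of their own). -/
example : Registered.stub_omegaLimitTransfer := stub_omegaLimitTransfer
example : Registered.stub_stationaryRigidity := stub_stationaryRigidity
example : Registered.stub_genericCensoredCapture := stub_genericCensoredCapture

/-! ## The composition: the crux BY NAME from the three stub statements (no `sorry`) -/

/-- **`StationaryLimitReduction` from the three stubs, BY NAME.** Given X, stub 1 fed with stub 2 is the
pointwise `C⁰` settling theorem T; tame Christodoulou-genericity (codimension 1) is monotone in the property;
pointwise on admissible data, the generic clause of stub 3 (MGHD existence, complete `𝓘⁺`, the `C⁰ ⇒ C²`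
sub-extremal upgrade) and T give the Statement's property. -/
theorem StationaryLimitReduction_of
    (h₁ : Registered.stub_omegaLimitTransfer) (h₂ : Registered.stub_stationaryRigidity)
    (h₃ : Registered.stub_genericCensoredCapture) :
    Summit.FinalStateConjecture.FinalStateConjecture.Theses.TemporalBandLiouville.StationaryLimitReduction := by
  intro hX X i₁ i₂ i₃ i₄ i₅ i₆
  -- the pointwise C⁰ settling theorem T from the eternal Liouville theorem X and eternal rigidity U
  have hT : EternalPapapetrou.CompleteScriSettlesC0 := h₁ hX h₂
  -- TAME Christodoulou-genericity (codimension 1, one fixed end) is monotone in the property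
  have mono : ∀ {P Q : _ → Prop},
      (∀ D ∈ admissibleVacuumData X, Q D → P D) →
      InitialDataSet.IsTameChristodoulouGeneric (admissibleVacuumData X) Q 1 →
      InitialDataSet.IsTameChristodoulouGeneric (admissibleVacuumData X) P 1 := by
    intro P Q hQP hQ D hD
    obtain ⟨e, F, htame, himm, h0, hinj, hadm, hexc⟩ :=
      hQ D ⟨hD.1, fun h => hD.2 (hQP D hD.1 h)⟩
    exact ⟨e, F, htame, himm, h0, hinj, hadm,
      fun c hc hmem => hexc c hc ⟨hmem.1, fun h => hmem.2 (hQP _ hmem.1 h)⟩⟩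
  refine mono ?_ (h₃ X)
  -- pointwise on admissible data: thread RaysStayInClosure / HasExhaustiveCharts / IsFutureOriented through
  -- the C⁰ ⇒ C² sub-extremal upgrade of stub 3
  intro D hD hQ
  obtain ⟨hex, hQ'⟩ := hQ
  refine ⟨hex, fun 𝒟 hmax => ?_⟩
  obtain ⟨hcomp, hup⟩ := hQ' 𝒟 hmax
  obtain ⟨O, d₀, hO, hrays, hexh, hfut⟩ := hT X D hD 𝒟 hmax hcomp
  obtain ⟨O', d, hsub, hO', hrays', hexh', hfut'⟩ := hup O d₀ hO hrays hexh hfut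
  exact ⟨hcomp, O', d, hsub, hO', hrays', hexh', hfut'⟩


end Summit.FinalStateConjecture.FinalStateConjecture.Cruxes.StationaryLimitReduction.TemporalBandLiouvilleBirth
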